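import Summits.QuantumFields.BalabanUV.Beta.DshAn1Spread

/-!
# `BalabanUV.Beta.D1BFx.DshEntrySharp` — road «BF-x», binder row D1 (pricing letters for the `Dsh`-words of PART 24 HEAD §4 (b)): **A ROOTED AXIAL CONTOUR CROSSES A GIVEN
# BOND AT MOST ONCE, so `|treeGaugeAt ρ (bondInd α q) N z| ≤ 1` (not the contour LENGTH `n·N` of `AxialDressingRooted.abs_treeGaugeAt_bondInd_le`), hence
# `|symTreeGaugeAt ρ (bondIndR α q) N x| ≤ n!`, `|lam04 N α x Y| ≤ N^{d+1}`, `|dz (lam04 N α x) m Y| ≤ N^{d+1}` (one-point support) and an1's symmetrised border shift has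
# `|Dsh N x y a b| ≤ N^{d+1}`** — one factor `2·(d+1)·N` below `DshAn1Spread.cDsh d N = 2·N^{d+1}·((d+1)·N)` (Q-g32-1 of leaf-01 g32 INTENT-1 l.52468; an1 g82 W-12 l.52546:
# «a letter of the shape “the rooted axial path meets a given bond at most once” is NOT TYPED … YOUR lemma over `axial` ∕ `treeGaugeAt` BY NAME (road side)»).

HONEST DEPENDENCY (cell records, verbatim): «continuum YM on T⁴ ⇐ BetaPertH ∧ nine spine estimates (0/9 proved); BetaPertH ⇐ (D1) ∧ (D4) ∧
CAP+tail; G-an2-4 gates asym, D1 and NE2/3/4.»  HONEST FRAMING (cell contract, verbatim): «discharging `BetaPertH` makes Bałaban's UV stability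
UNCONDITIONAL — a real constructive-QFT result; it is NOT the continuum limit and NOT the Clay problem.»  THIS MODULE is [folklore] list∕lattice-path bookkeeping over
lit-balaban's `AveragingContours.seg ∕ axialAux ∕ axial`, an2's `bondInd`, an1's `symTreeGaugeAt ∕ lam04 ∕ Dsh` BY NAME; it SHARPENS an entry letter, it prices NO (1.22) row and
changes no identity.  No `def`, no `def … : Prop`, nothing cited, NO printed hypothesis, 0 sorry.  0 root-level binders of row D1 discharged; (K) NOT closed; (J1) ONE OPEN ROW;
NOT D1, NEVER «G-an2-4 closed», NOT `BetaPertH`, NOT continuum, NOT Clay.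

ABSOLUTE RULE (cell charter, verbatim): «No internally-minted statement may enter as a cited fact. Every hypothesis is either kernel-proved in
this package or a verbatim quotation of a PUBLISHED theorem with page reference. The manuscript(s) under audit are NOT citable for their own
disputed steps — they are the thing under adjudication; programme-internal (2001/route/tribunal) claims are never citable.»

CONTENT.  §1 `seg_bondInd_sum_eq_zero_of_ne` (an axis `κ ≠ α` never reads the bond `(α, q)`), `segUp_bondInd_sum_aux` ∕ `segDown_bondInd_sum_aux` ∕ `abs_seg_bondInd_sum_le_one`
(a straight segment reads a given bond at most once: `s ↦ z ± s•e_κ` is injective), `abs_axialAux_bondInd_sum_le`,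
**`abs_treeGaugeAt_bondInd_le_one`** (any root `ρ`).  §2 `abs_symTreeGaugeAt_bondIndR_le_factorial`, **`abs_lam04_le_pow`**, `abs_dz_lam04_le_pow`, **`abs_Dsh_le_pow`**
(`|Dsh N x y a b| ≤ N^{d+1}`, `1 ≤ N`), `decays_Dsh_pow` (every rate, constant `N^{d+1}·e^{δ(d+1)(2N)}`).
Unit `b2b-balaban-beta-d1-formalise-leaf-01` (gen 32), D1 formalisation swarm LEAF PROVER 01, road «BF-x».  Not in print; our bookkeeping.  No existing file touched.
-/

noncomputable section

namespace Summit.QuantumFields.BalabanUV.Beta.D1BFx.DshEntrySharp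

open Finset
open scoped BigOperators Nat
open Literature.MathematicalPhysics.QuantumFieldTheory
open Literature.MathematicalPhysics.QuantumFieldTheory.Balaban1983to89
open Literature.MathematicalPhysics.QuantumFieldTheory.Balaban1983to89.Beta
open B12Sec2to5 (l1)
open AffineAveraging (Form1 Site unitVec unitVec_apply dz box toSite)
open Summit.QuantumFields.BalabanUV.Beta.AxialDressingRooted (l1_le_of_mem_cube)
open AveragingContours (seg segUp segDown segUp_zero segDown_zero segUp_succ segDown_succ axial axialAux blk)
open AveragingContoursRooted (ctr treeGaugeAt)
open KKTFluctuationKernel (delta1)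
open OneStepResolventKernel (Fib)
open LatticeForm (quo)
open Literature.Probability.LatticeModels (Torus.proj)
open Summit.QuantumFields.BalabanUV.Beta.AxialDressingRooted (bondInd bondInd_apply abs_bondInd_le)
open Summit.QuantumFields.BalabanUV.Beta.SymmetrisedAxialPotential (symTreeGaugeAt symTreeGaugeAt_eq_sum card_perm_fin)
open Summit.QuantumFields.BalabanUV.Beta.KernelPermutation (psite)
open Summit.QuantumFields.BalabanUV.Beta.ResolventPermutation (P1)
open Summit.QuantumFields.BalabanUV.Beta.SymmetrisedDressingMatrix (bondIndR P1_bondIndR treeGaugeAt_bondIndR)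
open Summit.QuantumFields.BalabanUV.Beta.SymGaugeMultiplierBlockMean (bondIndR_eq_delta1)
open Summit.QuantumFields.BalabanUV.Beta.DshAn1 (lam04 Dsh Dsh_inl_inl Dsh_inl_inr Dsh_inr_inl Dsh_inr_inr lam04_eq_zero_of_ne_blk SymLamAt_eq_sum_symTreeGaugeAt)

variable {n : ℕ}

/-! ## §1 A rooted axial contour crosses a given bond at most once -/

/-- [folklore] Two points of a straight line in direction `κ` that coincide have the same parameter (`+` parametrisation). -/
theorem eq_of_add_zsmul_unitVec_eq {z q : Fin n → ℤ} {κ : Fin n} {s t : ℤ} (hs : z + s • unitVec κ = q) (ht : z + t • unitVec κ = q) : s = t := by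
  have h := congrFun (hs.trans ht.symm) κ
  simpa [unitVec_apply] using h

/-- [folklore] The same for the `−` parametrisation. -/
theorem eq_of_sub_zsmul_unitVec_eq {z q : Fin n → ℤ} {κ : Fin n} {s t : ℤ} (hs : z - s • unitVec κ = q) (ht : z - t • unitVec κ = q) : s = t := by
  have h := congrFun (hs.trans ht.symm) κ
  simpa [unitVec_apply] using h

/-- [folklore] AN AXIS `κ ≠ α` NEVER READS THE BOND `(α, q)`, upward segments. -/
theorem segUp_bondInd_sum_eq_zero_of_ne {α κ : Fin n} (hκ : κ ≠ α) (q z : Fin n → ℤ) : ∀ m : ℕ, (segUp (bondInd α q) z κ m).sum = 0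
  | 0 => by rw [segUp_zero, List.sum_nil]
  | m + 1 => by
    rw [segUp_succ, List.sum_append, List.sum_singleton, segUp_bondInd_sum_eq_zero_of_ne hκ q z m, zero_add, bondInd_apply, if_neg]
    exact fun h => hκ h.1

/-- [folklore] AN AXIS `κ ≠ α` NEVER READS THE BOND `(α, q)`, downward segments. -/
theorem segDown_bondInd_sum_eq_zero_of_ne {α κ : Fin n} (hκ : κ ≠ α) (q z : Fin n → ℤ) : ∀ m : ℕ, (segDown (bondInd α q) z κ m).sum = 0
  | 0 => by rw [segDown_zero, List.sum_nil]
  | m + 1 => by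
    rw [segDown_succ, List.sum_append, List.sum_singleton, segDown_bondInd_sum_eq_zero_of_ne hκ q z m, zero_add, bondInd_apply, if_neg, neg_zero]
    exact fun h => hκ h.1

/-- [folklore] AN AXIS `κ ≠ α` NEVER READS THE BOND `(α, q)`: every straight segment in direction `κ` has `bondInd α q`-sum zero. -/
theorem seg_bondInd_sum_eq_zero_of_ne {α κ : Fin n} (hκ : κ ≠ α) (q z : Fin n → ℤ) (m : ℤ) : (seg (bondInd α q) z κ m).sum = 0 := by
  unfold seg
  split
  · exact segUp_bondInd_sum_eq_zero_of_ne hκ q z _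
  · exact segDown_bondInd_sum_eq_zero_of_ne hκ q z _

/-- [folklore] An upward segment reads ANY bond at most once: `|sum| ≤ 1`, and a non-zero sum locates the bond's base point ON the segment. -/
theorem segUp_bondInd_sum_aux (α κ : Fin n) (q z : Fin n → ℤ) : ∀ m : ℕ,
    |(segUp (bondInd α q) z κ m).sum| ≤ 1 ∧ ((segUp (bondInd α q) z κ m).sum ≠ 0 → ∃ s : ℕ, s < m ∧ z + (s : ℤ) • unitVec κ = q)
  | 0 => by simp
  | m + 1 => by
    obtain ⟨ih1, ih2⟩ := segUp_bondInd_sum_aux α κ q z m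
    rw [segUp_succ, List.sum_append, List.sum_singleton]
    by_cases hm : z + (m : ℤ) • unitVec κ = q
    · have h0 : (segUp (bondInd α q) z κ m).sum = 0 := by
        by_contra h
        obtain ⟨s, hs, hs'⟩ := ih2 h
        have := eq_of_add_zsmul_unitVec_eq hs' hm
        omega
      rw [h0, zero_add]
      exact ⟨abs_bondInd_le α q κ _, fun _ => ⟨m, Nat.lt_succ_self m, hm⟩⟩
    · have h0 : bondInd α q κ (z + (m : ℤ) • unitVec κ) = 0 := by
        rw [bondInd_apply, if_neg]; exact fun h => hm h.2
      rw [h0, add_zero]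
      exact ⟨ih1, fun h => let ⟨s, hs, hs'⟩ := ih2 h; ⟨s, Nat.lt_succ_of_lt hs, hs'⟩⟩

/-- [folklore] A downward segment reads ANY bond at most once (same statement, `−` parametrisation). -/
theorem segDown_bondInd_sum_aux (α κ : Fin n) (q z : Fin n → ℤ) : ∀ m : ℕ,
    |(segDown (bondInd α q) z κ m).sum| ≤ 1 ∧ ((segDown (bondInd α q) z κ m).sum ≠ 0 → ∃ s : ℕ, s < m ∧ z - ((s : ℤ) + 1) • unitVec κ = q)
  | 0 => by simp
  | m + 1 => by
    obtain ⟨ih1, ih2⟩ := segDown_bondInd_sum_aux α κ q z m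
    rw [segDown_succ, List.sum_append, List.sum_singleton]
    by_cases hm : z - ((m : ℤ) + 1) • unitVec κ = q
    · have h0 : (segDown (bondInd α q) z κ m).sum = 0 := by
        by_contra h
        obtain ⟨s, hs, hs'⟩ := ih2 h
        have := eq_of_sub_zsmul_unitVec_eq hs' hm
        omega
      rw [h0, zero_add, abs_neg]
      exact ⟨abs_bondInd_le α q κ _, fun _ => ⟨m, Nat.lt_succ_self m, hm⟩⟩
    · have h0 : bondInd α q κ (z - ((m : ℤ) + 1) • unitVec κ) = 0 := by
        rw [bondInd_apply, if_neg]; exact fun h => hm h.2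
      rw [h0, neg_zero, add_zero]
      exact ⟨ih1, fun h => let ⟨s, hs, hs'⟩ := ih2 h; ⟨s, Nat.lt_succ_of_lt hs, hs'⟩⟩

/-- [folklore] A STRAIGHT SEGMENT READS A GIVEN BOND AT MOST ONCE: `|Σ (seg (bondInd α q) z κ m)| ≤ 1`. -/
theorem abs_seg_bondInd_sum_le_one (α κ : Fin n) (q z : Fin n → ℤ) (m : ℤ) : |(seg (bondInd α q) z κ m).sum| ≤ 1 := by
  unfold seg
  split
  · exact (segUp_bondInd_sum_aux α κ q z _).1
  · exact (segDown_bondInd_sum_aux α κ q z _).1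

/-- [folklore] The partial axial contour (axes `m−1, …, 0`) reads the bond `(α, q)` only on the axis `α`: `|Σ (axialAux (bondInd α q) y x m)| ≤ [α < m]`. -/
theorem abs_axialAux_bondInd_sum_le (α : Fin n) (q y x : Fin n → ℤ) :
    ∀ m : ℕ, |(axialAux (bondInd α q) y x m).sum| ≤ if (α : ℕ) < m then 1 else 0
  | 0 => by simp [axialAux]
  | m + 1 => by
    have ih := abs_axialAux_bondInd_sum_le α q y x m
    simp only [axialAux, List.sum_append]
    by_cases hm : m < n
    · rw [dif_pos hm]
      by_cases hα : (⟨m, hm⟩ : Fin n) = α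
      · -- the axis `α`: the segment reads the bond at most once, the earlier axes never
        have hlt : ¬ (α : ℕ) < m := by rw [← hα]; exact lt_irrefl m
        rw [if_neg hlt] at ih
        have h0 : (axialAux (bondInd α q) y x m).sum = 0 := abs_nonpos_iff.1 ih
        rw [h0, add_zero, hα, if_pos (by rw [← hα]; exact Nat.lt_succ_self m)]
        exact abs_seg_bondInd_sum_le_one α _ q _ _
      · rw [seg_bondInd_sum_eq_zero_of_ne hα, zero_add]
        exact ih.trans (by split_ifs <;> omega)
    · rw [dif_neg hm, List.sum_nil, zero_add]
      exact ih.trans (by split_ifs <;> omega)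

/-- [folklore] **A ROOTED AXIAL CONTOUR CROSSES A GIVEN BOND AT MOST ONCE**: `|Σ (axial (bondInd α q) y x)| ≤ 1` for all endpoints. -/
theorem abs_axial_bondInd_sum_le_one (α : Fin n) (q y x : Fin n → ℤ) : |(axial (bondInd α q) y x).sum| ≤ 1 :=
  (abs_axialAux_bondInd_sum_le α q y x n).trans (by split_ifs <;> simp)

/-- [folklore] **THE ROOTED TREE GAUGE OF A BOND INDICATOR IS `0` OR `±1`** (any root `ρ`, any blocking `N`): `|treeGaugeAt ρ (bondInd α q) N z| ≤ 1` — the sharp form of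
`AxialDressingRooted.abs_treeGaugeAt_bondInd_le` (`≤ n·N`, the contour length). -/
theorem abs_treeGaugeAt_bondInd_le_one (ρ : Fin n → ℤ) (α : Fin n) (q : Fin n → ℤ) (N : ℕ) (z : Fin n → ℤ) :
    |treeGaugeAt ρ (bondInd α q) N z| ≤ 1 :=
  abs_axial_bondInd_sum_le_one α q _ z

/-! ## §2 The symmetrised tree gauge, an1's one-block potential `lam04` and the border shift `Dsh` -/

/-- [folklore] **`|symTreeGaugeAt ρ (bondIndR α q) N x| ≤ n!`** (any root; sharp form of `SymmetrisedDressingMatrix.abs_symTreeGaugeAt_bondIndR_le`'s `n!·(n·N)`). -/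
theorem abs_symTreeGaugeAt_bondIndR_le_factorial (ρ : Fin n → ℤ) (α : Fin n) (q : Fin n → ℤ) (N : ℕ) (x : Fin n → ℤ) :
    |symTreeGaugeAt ρ (bondIndR α q) N x| ≤ (n ! : ℝ) := by
  rw [symTreeGaugeAt_eq_sum]
  refine (Finset.abs_sum_le_sum_abs _ _).trans ?_
  have hterm : ∀ σ ∈ (Finset.univ : Finset (Equiv.Perm (Fin n))),
      |treeGaugeAt ((psite σ).symm ρ) (P1 σ (bondIndR α q)) N
        ((psite σ).symm x)| ≤ (1 : ℝ) := by
    intro σ _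
    rw [P1_bondIndR, treeGaugeAt_bondIndR]
    have h := abs_treeGaugeAt_bondInd_le_one ((psite σ).symm ρ) (σ.symm α)
      ((psite σ).symm q) N ((psite σ).symm x)
    have h' : ((|treeGaugeAt ((psite σ).symm ρ) (bondInd (σ.symm α) ((psite σ).symm q)) N
        ((psite σ).symm x)| : ℤ) : ℝ) ≤ ((1 : ℤ) : ℝ) := by exact_mod_cast h
    rw [Int.cast_abs] at h'
    push_cast at h'
    exact h'
  refine (Finset.sum_le_sum hterm).trans ?_
  rw [Finset.sum_const, Finset.card_univ, card_perm_fin, nsmul_eq_mul, mul_one]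

variable {d : ℕ}

/-- [folklore] **`|lam04 N α x Y| ≤ N^{d+1}`** (`N^{d+1}` block points, each symmetrised tree gauge of the bond indicator `≤ (d+1)!`, weight `((d+1)!)⁻¹`) — sharp form of
`DshAn1Spread.abs_lam04_le` (`≤ N^{d+1}·((d+1)·N)`). -/
theorem abs_lam04_le_pow (N : ℕ) (α : Fin (d + 1)) (x Y : Fin (d + 1) → ℤ) : |lam04 N α x Y| ≤ (N : ℝ) ^ (d + 1) := by
  rw [lam04, SymLamAt_eq_sum_symTreeGaugeAt, abs_mul, abs_inv, Nat.abs_cast]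
  have hterm : ∀ b ∈ box (d + 1) N, |symTreeGaugeAt (ctr (d + 1) N) (delta1 α x) N ((N : ℤ) • Y + toSite b)| ≤ ((d + 1) ! : ℝ) := by
    intro b _
    rw [← bondIndR_eq_delta1]
    exact abs_symTreeGaugeAt_bondIndR_le_factorial _ α x N _
  have hsum := (Finset.abs_sum_le_sum_abs _ _).trans (Finset.sum_le_sum hterm)
  have hcard : (box (d + 1) N).card = N ^ (d + 1) := by
    simp [AffineAveraging.box, Fintype.card_piFinset, Finset.card_range, Finset.prod_const, Finset.card_univ, Fintype.card_fin]
  rw [Finset.sum_const, hcard, nsmul_eq_mul] at hsum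
  push_cast at hsum
  have hf : (0 : ℝ) < ((d + 1) ! : ℝ) := by exact_mod_cast Nat.factorial_pos _
  calc ((d + 1) ! : ℝ)⁻¹ * |∑ b ∈ box (d + 1) N, symTreeGaugeAt (ctr (d + 1) N) (delta1 α x) N ((N : ℤ) • Y + toSite b)|
      ≤ ((d + 1) ! : ℝ)⁻¹ * ((N : ℝ) ^ (d + 1) * ((d + 1) ! : ℝ)) := mul_le_mul_of_nonneg_left hsum (inv_nonneg.2 hf.le)
    _ = (N : ℝ) ^ (d + 1) := by field_simp

/-- [folklore] **`|dz (lam04 N α x) m Y| ≤ N^{d+1}`** — the one-block potential is supported on the single coarse point `blk N x` (`DshAn1Spread.lam04_eq_zero_of_ne_blk`),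
so at most ONE of the two readings of the coarse difference is non-zero (sharp form of `DshAn1Spread.abs_dz_lam04_le ≤ cDsh d N`). -/
theorem abs_dz_lam04_le_pow {N : ℕ} (hN : 1 ≤ N) (α m : Fin (d + 1)) (x Y : Fin (d + 1) → ℤ) : |dz (lam04 N α x) m Y| ≤ (N : ℝ) ^ (d + 1) := by
  rw [dz]
  by_cases hY : Y = blk N x
  · have hY' : Y + unitVec m ≠ blk N x := by
      rw [hY]; intro h
      have := congrFun h m
      simp [unitVec_apply] at this
    rw [lam04_eq_zero_of_ne_blk hN hY', zero_sub, abs_neg]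
    exact abs_lam04_le_pow N α x Y
  · rw [lam04_eq_zero_of_ne_blk hN hY, sub_zero]
    exact abs_lam04_le_pow N α x _

/-- [folklore] **SHARP ENTRY LETTER OF an1's BORDER SHIFT**: `|Dsh N x y a b| ≤ N^{d+1}` for `1 ≤ N` (vs. `DshAn1Spread.abs_Dsh_le`'s `cDsh d N = 2·N^{d+1}·((d+1)·N)`). -/
theorem abs_Dsh_le_pow {N : ℕ} (hN : 1 ≤ N) (x y : Fin (d + 1) → ℤ) (a b : Fib d) : |Dsh N x y a b| ≤ (N : ℝ) ^ (d + 1) := by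
  rcases a with α | m <;> rcases b with β | m'
  · rw [Dsh_inl_inl, abs_zero]; positivity
  · rw [Dsh_inl_inr]
    split_ifs
    · exact abs_dz_lam04_le_pow hN α m' x _
    · rw [abs_zero]; positivity
  · rw [Dsh_inr_inl]
    split_ifs
    · rw [abs_neg]; exact abs_dz_lam04_le_pow hN β m y _
    · rw [abs_zero]; positivity
  · rw [Dsh_inr_inr, abs_zero]; positivity

/-- [folklore] **`Dsh N` DECAYS AT EVERY RATE WITH THE SHARP CONSTANT** `N^{d+1}·e^{δ(d+1)(2N)}` (finite window `cube (d+1) (2N)`, an1's `Dsh_ne_zero_window`; the sharp twin of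
`DshAn1Spread.decays_Dsh`, whose constant reads `cDsh d N·e^{δ(d+1)(2N)}`). -/
theorem decays_Dsh_pow {N : ℕ} (hN : 1 ≤ N) {δ : ℝ} (hδ : 0 ≤ δ) :
    ExpKernelCalculus.Decays (Dsh (d := d) N) ((N : ℝ) ^ (d + 1) * Real.exp (δ * (((d : ℝ) + 1) * (2 * N)))) δ := by
  intro x y a b
  by_cases h0 : Dsh N x y a b = 0
  · rw [h0, abs_zero]; positivity
  · have hxy := DshAn1.Dsh_ne_zero_window hN h0
    have hl : l1 (x - y) ≤ ((d : ℝ) + 1) * (2 * N) := by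
      have := l1_le_of_mem_cube hxy
      push_cast at this
      linarith
    calc |Dsh N x y a b| ≤ (N : ℝ) ^ (d + 1) * 1 := by rw [mul_one]; exact abs_Dsh_le_pow hN x y a b
      _ ≤ (N : ℝ) ^ (d + 1) * (Real.exp (δ * (((d : ℝ) + 1) * (2 * N))) * Real.exp (-δ * l1 (x - y))) := by
          refine mul_le_mul_of_nonneg_left ?_ (by positivity)
          rw [← Real.exp_add]
          exact Real.one_le_exp (by nlinarith)
      _ = (N : ℝ) ^ (d + 1) * Real.exp (δ * (((d : ℝ) + 1) * (2 * N))) * Real.exp (-δ * l1 (x - y)) := by ring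

end Summit.QuantumFields.BalabanUV.Beta.D1BFx.DshEntrySharp

end
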